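import Summits.NavierStokesRegularity.FluidComputer.PalasekTowerRegisterGlobalAt
import Summits.NavierStokesRegularity.FluidComputer.PalasekTowerHeredityOrBreakdownAt

/-!
# REGISTER v2.3′ AT ARBITRARY RATES, II: the R-GENERIC FACE LAYER — `NoPrematureBreakdownGAt R k`,
# `HeredityOrBreakdownGAt R k`, `WindowCeilingGAt R k`, `LocalContinuationGAt R k`, `AprioriCeilingGAt R k`,
# `ContinuationEnvelopeGAt R k`, `ReadoutGAt R k P`, `ReadoutFloorsGAt R k`, `SpeedFloorGAt / StrainFloorGAt /
# CoreFloorGAt R k`, their `wide ↔` identities and the level-`k` splits, for any `R : TowerRates`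

Cell `ns-blowup`, seat `ns-blowup-fc-prover-2` (g9; D-0074 GROUP C «BRIDGE SUPPORT»; typing ask of the PTB tenure
planner g23, STATUS 2026-08-27T10:55Z (iii)). Companion of `PalasekTowerRegisterGlobalAt.lean` (p517439: the G-layer
`EpisodeBaseGAt R` / `HeredityAtGAt R k` / `HeredityFromGAt R k₀` and the closer at any `R`). LABEL: E–C typing
(KERNEL vocabulary + glue). WHAT THIS IS NOT: not Navier–Stokes evidence — named OPEN `Prop`s PARAMETRISED by the
rates record, ported VERBATIM from their `wide` originals (`PalasekTowerHeredityOrBreakdown.lean` §3,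
`PalasekTowerHeredityOrBreakdownCeiling.lean` §2, `PalasekTowerRegisterGlobalEnvelopeAt.lean` §0/§2,
`PalasekTowerRegisterGlobalEnvelopeAtHolds.lean` §2, `PalasekTowerRegisterGlobalHalvesAt.lean` §1,
`PalasekTowerRegisterGlobalFloorsAt.lean` §1–§2, `PalasekTowerHeredityOrBreakdownAt.lean` §1–§2) with `TowerRates.wide`
replaced by `R`, together with their logical and continuation-principle glue; nothing is inhabited or asserted;
NO item is filed or restated (the items of record at `wide` — 19178/19179/19249/19250, now asides — and at
`tuned` — 20303/20304/20305 — are untouched; every predicate below reduces to its `wide` original at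
`R = TowerRates.wide` DEFINITIONALLY, `Iff.rfl`, stated in §2).

## Why (planner word, STATUS 2026-08-27T10:55Z (iii))

After the RE-BASE of the PTB route to `TowerRates.tuned` (rev 19) the live cruxes are `EpisodeBaseT` /
`HeredityAtOneT := HeredityAtGAt tuned 1` / `HeredityFromTwoT := HeredityFromGAt tuned 2`. The five-face birth
skeletons of the wide child cruxes (`NoPrematureBreakdown ∧ WindowCeiling ∧ SpeedFloor ∧ StrainFloor ∧ CoreFloor`)
do not port to 20304/20305 by substitution, because every face predicate of the tree is pinned to
`TowerRates.wide`. This file (part I) supplies the faces at `(R, k)`, their `wide ↔` identities and the LOGICAL layer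
(`heredityAtGAt_iff_orBreakdown_and_noPrematureBreakdown`, (C) from a premature breakdown at any rates,
`HeredityOrBreakdownGAt.windowCeiling`, the readout schema calculus and the three-floor split of the lower half); the
companion part II `PalasekTowerFaceLayerAtEnvelope.lean` re-proves at `(R, k)` the continuation-principle splits
`aprioriCeilingGAt_iff_noPrematureBreakdown_and_windowCeiling` (`k ≥ 1`),
`heredityOrBreakdownGAt_iff_windowCeiling_and_readoutFloors` and
`heredityAtGAt_iff_noPrematureBreakdown_windowCeiling_readoutFloors` — every helper they use being generic in the
rates already.

References: S. Palasek, arXiv:2605.13827 §3–§4 [cite: Palasek2026ElementaryModel, §3–§4]; H. Sohr, *The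
Navier–Stokes Equations*, Birkhäuser 2001, Ch. V Thm. 1.5.1 [cite: Sohr2001, Ch. V Thm. 1.5.1]; J. C. Robinson,
J. L. Rodrigo, W. Sadowski, CUP 2016, Thm. 8.17 [cite: RobinsonRodrigoSadowski2016, Thm. 8.17]; T. Tao, Anal. PDE 6
(2013), Thm. 5.4 [cite: Tao2011, Thm. 5.4 (ii)+(iv)]; C. L. Fefferman, Clay problem description, (C)
[cite: FeffermanClay2006, (C)].
-/

noncomputable section

namespace Summit.NavierStokesRegularity.FluidComputer.PalasekTowerClayBridge

open Set MeasureTheory Filter Topology Function Real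
open scoped ENNReal ContDiff NNReal
open Literature.Analysis.FluidPDE
open Summit.NavierStokesRegularity.NavierStokesRegularity

/-! ## §1 The faces at arbitrary rates (open `Prop`s; never asserted) -/

/-- **HEREDITY OR BREAKDOWN at level `k`, rates `R`** (open; never asserted): every globally anchored registered
stage at level `k` of a pinned (`Λ = 8`, `θ = 6/5`), rigid, quiet design on the rates `R`, at unit viscosity,
EITHER belongs to a design whose flow does not live to `τ (k+1)` OR extends to a registered stage at level `k + 1`.
At `R = wide`: `HeredityOrBreakdownAt k`. [cite: Palasek2026ElementaryModel, §4] -/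
@[conjecture] def HeredityOrBreakdownGAt (R : TowerRates) (k : ℕ) : Prop :=
  ∀ S : Schedule R, S.Pins 8 (6 / 5) → S.Rigid → S.Quiet →
    ∀ s : Stage 1 R S (Margins.routeG R) k,
      ¬ S.LivesTo 1 (S.τ (k + 1)) ∨ ∃ s' : Stage 1 R S (Margins.routeG R) (k + 1), s.Extends s'

/-- **Heredity or breakdown FROM level `k₀` on, rates `R`** (open; never asserted). At `R = wide`:
`HeredityOrBreakdownFrom k₀`. [cite: Palasek2026ElementaryModel, §4] -/
@[conjecture] def HeredityOrBreakdownFromGAt (R : TowerRates) (k₀ : ℕ) : Prop :=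
  ∀ k : ℕ, k₀ ≤ k → HeredityOrBreakdownGAt R k

/-- **No premature breakdown at level `k`, rates `R`** (open; never asserted): every pinned rigid quiet design on `R`
that earned a registered stage at level `k` has a flow living (classically, with finite energy) to `τ (k+1)`. Its
NEGATION proves (C) (`navierStokesBreakdownR3_of_not_noPrematureBreakdownGAt`). At `R = wide`:
`NoPrematureBreakdownAt k`. [cite: Palasek2026ElementaryModel, §4] -/
@[conjecture] def NoPrematureBreakdownGAt (R : TowerRates) (k : ℕ) : Prop :=
  ∀ S : Schedule R, S.Pins 8 (6 / 5) → S.Rigid → S.Quiet →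
    Nonempty (Stage 1 R S (Margins.routeG R) k) → S.LivesTo 1 (S.τ (k + 1))

/-- **The WINDOW CEILING at level `k`, rates `R`** (open; never asserted): for every pinned rigid quiet design on `R`
with a registered stage at level `k`, every classical finite-energy solution of the design's system from its Clay
datum on the full slab `[0, τ (k+1)]` stays below `c₂ Y_{k+1}` on the growth window `[τ k, τ (k+1)]`. At `R = wide`:
`WindowCeilingAt k`. [cite: Palasek2026ElementaryModel, §4] -/
@[conjecture] def WindowCeilingGAt (R : TowerRates) (k : ℕ) : Prop :=
  ∀ S : Schedule R, S.Pins 8 (6 / 5) → S.Rigid → S.Quiet →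
    ∀ s : Stage 1 R S (Margins.routeG R) k,
    ∀ (v : ℝ → EuclideanSpace ℝ (Fin 3) → EuclideanSpace ℝ (Fin 3))
      (q : ℝ → EuclideanSpace ℝ (Fin 3) → ℝ),
      IsClassicalNSSolutionOn (Icc 0 (S.τ (k + 1))) 1 S.f v q → v 0 = S.u₀ →
      (∃ C : ℝ≥0∞, C < ⊤ ∧ ∀ t ∈ Icc 0 (S.τ (k + 1)), ∫⁻ x, ‖v t x‖ₑ ^ 2 ≤ C) →
      ∀ t ∈ Icc (S.τ k) (S.τ (k + 1)), ∀ x, ‖v t x‖ ≤ S.c₂ * R.Y (k + 1)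

/-- **LOCAL CONTINUATION AT level `k`, rates `R`** (a THEOREM at every `(R, k)`, `localContinuationGAt_holds`;
kept as a named face for the skeletons): every registered level-`k` stage of a pinned rigid quiet design on `R`
continues classically under the design force, with finite energy, to SOME time `T' > τ k`, agreeing with the stage
on `[0, τ k]`. At `R = wide`: `LocalContinuationAt k`. [cite: Tao2011, Thm. 5.4 (ii)+(iv)] -/
@[conjecture] def LocalContinuationGAt (R : TowerRates) (k : ℕ) : Prop :=
  ∀ S : Schedule R, S.Pins 8 (6 / 5) → S.Rigid → S.Quiet →
    ∀ s : Stage 1 R S (Margins.routeG R) k,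
      ∃ T' : ℝ, S.τ k < T' ∧
        ∃ (u : ℝ → EuclideanSpace ℝ (Fin 3) → EuclideanSpace ℝ (Fin 3))
          (p : ℝ → EuclideanSpace ℝ (Fin 3) → ℝ),
          IsClassicalNSSolutionOn (Icc 0 T') 1 S.f u p ∧
          (∀ t ∈ Icc 0 (S.τ k), u t = s.u t ∧ p t = s.p t) ∧
          (∃ C : ℝ≥0∞, C < ⊤ ∧ ∀ t ∈ Icc 0 T', ∫⁻ x, ‖u t x‖ₑ ^ 2 ≤ C)

/-- **A-PRIORI CEILING AT level `k`, rates `R` — no overshoot** (open; never asserted): for every pinned rigid quiet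
design on `R`, every registered level-`k` stage, every `T' ∈ [τ k, τ (k+1)]` and every finite-energy classical
continuation of the stage on `[0, T']` (design force; agreement on `[0, τ k]`), the speed stays `≤ c₂ Y_{k+1}` on
`[0, T'] × ℝ³`. At `R = wide`: `AprioriCeilingAt k`. [cite: Palasek2026ElementaryModel, §4] -/
@[conjecture] def AprioriCeilingGAt (R : TowerRates) (k : ℕ) : Prop :=
  ∀ S : Schedule R, S.Pins 8 (6 / 5) → S.Rigid → S.Quiet →
    ∀ s : Stage 1 R S (Margins.routeG R) k,
    ∀ T' ∈ Icc (S.τ k) (S.τ (k + 1)),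
    ∀ (u : ℝ → EuclideanSpace ℝ (Fin 3) → EuclideanSpace ℝ (Fin 3))
      (p : ℝ → EuclideanSpace ℝ (Fin 3) → ℝ),
      IsClassicalNSSolutionOn (Icc 0 T') 1 S.f u p →
      (∀ t ∈ Icc 0 (S.τ k), u t = s.u t ∧ p t = s.p t) →
      (∃ C : ℝ≥0∞, C < ⊤ ∧ ∀ t ∈ Icc 0 T', ∫⁻ x, ‖u t x‖ₑ ^ 2 ≤ C) →
      ∀ t ∈ Icc 0 T', ∀ x, ‖u t x‖ ≤ S.c₂ * R.Y (k + 1)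

/-- **UPPER HALF AT level `k`, rates `R` — the continuation envelope** (open; never asserted): every registered
level-`k` stage of a pinned rigid quiet design on `R` continues classically (design force) to `τ (k+1)` with finite
energy, inside the next ceiling `c₂ Y_{k+1}`. At `R = wide`: `ContinuationEnvelopeAt k`. [cite: Palasek2026ElementaryModel, §4] -/
@[conjecture] def ContinuationEnvelopeGAt (R : TowerRates) (k : ℕ) : Prop :=
  ∀ S : Schedule R, S.Pins 8 (6 / 5) → S.Rigid → S.Quiet →
    ∀ s : Stage 1 R S (Margins.routeG R) k,
      ∃ (u : ℝ → EuclideanSpace ℝ (Fin 3) → EuclideanSpace ℝ (Fin 3))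
        (p : ℝ → EuclideanSpace ℝ (Fin 3) → ℝ),
        IsClassicalNSSolutionOn (Icc 0 (S.τ (k + 1))) 1 S.f u p ∧
        (∀ t ∈ Icc 0 (S.τ k), u t = s.u t ∧ p t = s.p t) ∧
        (∃ C : ℝ≥0∞, C < ⊤ ∧ ∀ t ∈ Icc 0 (S.τ (k + 1)), ∫⁻ x, ‖u t x‖ₑ ^ 2 ≤ C) ∧
        (∀ t ∈ Icc 0 (S.τ (k + 1)), ∀ x, ‖u t x‖ ≤ S.c₂ * R.Y (k + 1))

/-- **READOUT SCHEMA AT level `k`, rates `R`**: every pinned rigid quiet design `S` on `R`, every registered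
level-`k` stage `s`, and every classical solution `(u, p)` of the design's system on `[0, τ (k+1)]` agreeing with `s`
on `[0, τ k]`, of finite energy, inside the next ceiling, satisfy `P S (u (τ (k+1)))`. At `R = wide`: `ReadoutAt k P`.
[cite: Palasek2026ElementaryModel, §4] -/
def ReadoutGAt (R : TowerRates) (k : ℕ)
    (P : Schedule R → (EuclideanSpace ℝ (Fin 3) → EuclideanSpace ℝ (Fin 3)) → Prop) : Prop :=
  ∀ S : Schedule R, S.Pins 8 (6 / 5) → S.Rigid → S.Quiet →
    ∀ s : Stage 1 R S (Margins.routeG R) k,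
    ∀ (u : ℝ → EuclideanSpace ℝ (Fin 3) → EuclideanSpace ℝ (Fin 3))
      (p : ℝ → EuclideanSpace ℝ (Fin 3) → ℝ),
      IsClassicalNSSolutionOn (Icc 0 (S.τ (k + 1))) 1 S.f u p →
      (∀ t ∈ Icc 0 (S.τ k), u t = s.u t ∧ p t = s.p t) →
      (∃ C : ℝ≥0∞, C < ⊤ ∧ ∀ t ∈ Icc 0 (S.τ (k + 1)), ∫⁻ x, ‖u t x‖ₑ ^ 2 ≤ C) →
      (∀ t ∈ Icc 0 (S.τ (k + 1)), ∀ x, ‖u t x‖ ≤ S.c₂ * R.Y (k + 1)) →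
      P S (u (S.τ (k + 1)))

/-- **SPEED FLOOR AT level `k`, rates `R`** (open; never asserted): at `τ (k+1)` every tame continuation carries speed
`≥ c₁ Y_{k+1}` somewhere in the ball. At `R = wide`: `SpeedFloorAt k`. [cite: Palasek2026ElementaryModel, §4] -/
@[conjecture] def SpeedFloorGAt (R : TowerRates) (k : ℕ) : Prop :=
  ReadoutGAt R k (fun S v => ∃ x, ‖x‖ ≤ S.radius ∧ S.c₁ * R.Y (k + 1) ≤ ‖v x‖)

/-- **STRAIN FLOOR AT level `k`, rates `R`** (open; never asserted): at `τ (k+1)` every tame continuation carries a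
velocity gradient of operator norm `≥ c₁ A_{k+1}` somewhere in the ball. At `R = wide`: `StrainFloorAt k`.
[cite: Palasek2026ElementaryModel, §3.1] -/
@[conjecture] def StrainFloorGAt (R : TowerRates) (k : ℕ) : Prop :=
  ReadoutGAt R k (fun S v => ∃ x, ‖x‖ ≤ S.radius ∧ S.c₁ * R.A (k + 1) ≤ ‖fderiv ℝ v x‖)

/-- **CORE FLOOR AT level `k`, rates `R`** (open; never asserted): at `τ (k+1)` every tame continuation carries a
level-`(k+1)` core loop (a `C¹` closed curve in a ball of radius `1/N_{k+1}`, speed `≤ 8π/N_{k+1}`, circulation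
`≥ c₁ N_{k+1}^{β−2}`). At `R = wide`: `CoreFloorAt k`. [cite: Palasek2026ElementaryModel, §3.1] -/
@[conjecture] def CoreFloorGAt (R : TowerRates) (k : ℕ) : Prop :=
  ReadoutGAt R k (fun S v => ∃ (x : EuclideanSpace ℝ (Fin 3)) (γ : ℝ → EuclideanSpace ℝ (Fin 3)),
    ‖x‖ ≤ S.radius ∧ ContDiff ℝ 1 γ ∧ γ 0 = γ 1 ∧
    (∀ σ ∈ Icc (0 : ℝ) 1, γ σ ∈ Metric.closedBall x (1 / R.N (k + 1))) ∧
    (∀ σ ∈ Icc (0 : ℝ) 1, ‖deriv γ σ‖ ≤ 8 * π / R.N (k + 1)) ∧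
    S.c₁ * R.N (k + 1) ^ (R.β - 2) ≤ circulation v γ)

/-- **LOWER HALF AT level `k`, rates `R` — the readout floors** (open; never asserted): the schema read with the
three floors of level `k + 1` (speed, strain, core). At `R = wide`: `ReadoutFloorsAt k`. [cite: Palasek2026ElementaryModel, §4] -/
@[conjecture] def ReadoutFloorsGAt (R : TowerRates) (k : ℕ) : Prop :=
  ReadoutGAt R k (fun S v =>
    (∃ x, ‖x‖ ≤ S.radius ∧ S.c₁ * R.Y (k + 1) ≤ ‖v x‖) ∧
    (∃ x, ‖x‖ ≤ S.radius ∧ S.c₁ * R.A (k + 1) ≤ ‖fderiv ℝ v x‖) ∧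
    (∃ (x : EuclideanSpace ℝ (Fin 3)) (γ : ℝ → EuclideanSpace ℝ (Fin 3)),
      ‖x‖ ≤ S.radius ∧ ContDiff ℝ 1 γ ∧ γ 0 = γ 1 ∧
      (∀ σ ∈ Icc (0 : ℝ) 1, γ σ ∈ Metric.closedBall x (1 / R.N (k + 1))) ∧
      (∀ σ ∈ Icc (0 : ℝ) 1, ‖deriv γ σ‖ ≤ 8 * π / R.N (k + 1)) ∧
      S.c₁ * R.N (k + 1) ^ (R.β - 2) ≤ circulation v γ))

/-! ## §2 At `R = wide` these are the tree's faces, definitionally -/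

/-- `HeredityOrBreakdownGAt wide k ↔ HeredityOrBreakdownAt k` (definitional). [folklore] -/
theorem heredityOrBreakdownGAt_wide_iff (k : ℕ) :
    HeredityOrBreakdownGAt TowerRates.wide k ↔ HeredityOrBreakdownAt k := Iff.rfl

/-- `HeredityOrBreakdownFromGAt wide k₀ ↔ HeredityOrBreakdownFrom k₀` (definitional). [folklore] -/
theorem heredityOrBreakdownFromGAt_wide_iff (k₀ : ℕ) :
    HeredityOrBreakdownFromGAt TowerRates.wide k₀ ↔ HeredityOrBreakdownFrom k₀ := Iff.rfl

/-- `NoPrematureBreakdownGAt wide k ↔ NoPrematureBreakdownAt k` (definitional). [folklore] -/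
theorem noPrematureBreakdownGAt_wide_iff (k : ℕ) :
    NoPrematureBreakdownGAt TowerRates.wide k ↔ NoPrematureBreakdownAt k := Iff.rfl

/-- `WindowCeilingGAt wide k ↔ WindowCeilingAt k` (definitional). [folklore] -/
theorem windowCeilingGAt_wide_iff (k : ℕ) : WindowCeilingGAt TowerRates.wide k ↔ WindowCeilingAt k := Iff.rfl

/-- `LocalContinuationGAt wide k ↔ LocalContinuationAt k` (definitional). [folklore] -/
theorem localContinuationGAt_wide_iff (k : ℕ) :
    LocalContinuationGAt TowerRates.wide k ↔ LocalContinuationAt k := Iff.rfl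

/-- `AprioriCeilingGAt wide k ↔ AprioriCeilingAt k` (definitional). [folklore] -/
theorem aprioriCeilingGAt_wide_iff (k : ℕ) : AprioriCeilingGAt TowerRates.wide k ↔ AprioriCeilingAt k := Iff.rfl

/-- `ContinuationEnvelopeGAt wide k ↔ ContinuationEnvelopeAt k` (definitional). [folklore] -/
theorem continuationEnvelopeGAt_wide_iff (k : ℕ) :
    ContinuationEnvelopeGAt TowerRates.wide k ↔ ContinuationEnvelopeAt k := Iff.rfl

/-- `ReadoutGAt wide k P ↔ ReadoutAt k P` (definitional). [folklore] -/
theorem readoutGAt_wide_iff (k : ℕ)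
    (P : Schedule TowerRates.wide → (EuclideanSpace ℝ (Fin 3) → EuclideanSpace ℝ (Fin 3)) → Prop) :
    ReadoutGAt TowerRates.wide k P ↔ ReadoutAt k P := Iff.rfl

/-- `SpeedFloorGAt wide k ↔ SpeedFloorAt k` (definitional). [folklore] -/
theorem speedFloorGAt_wide_iff (k : ℕ) : SpeedFloorGAt TowerRates.wide k ↔ SpeedFloorAt k := Iff.rfl

/-- `StrainFloorGAt wide k ↔ StrainFloorAt k` (definitional). [folklore] -/
theorem strainFloorGAt_wide_iff (k : ℕ) : StrainFloorGAt TowerRates.wide k ↔ StrainFloorAt k := Iff.rfl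

/-- `CoreFloorGAt wide k ↔ CoreFloorAt k` (definitional). [folklore] -/
theorem coreFloorGAt_wide_iff (k : ℕ) : CoreFloorGAt TowerRates.wide k ↔ CoreFloorAt k := Iff.rfl

/-- `ReadoutFloorsGAt wide k ↔ ReadoutFloorsAt k` (definitional). [folklore] -/
theorem readoutFloorsGAt_wide_iff (k : ℕ) : ReadoutFloorsGAt TowerRates.wide k ↔ ReadoutFloorsAt k := Iff.rfl

/-! ## §3 The logical layer at `(R, k)` -/

variable {R : TowerRates}

/-- Heredity at level `k` implies heredity-or-breakdown at level `k`. [folklore] -/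
theorem HeredityAtGAt.orBreakdown {k : ℕ} (h : HeredityAtGAt R k) : HeredityOrBreakdownGAt R k :=
  fun S hP hR hQ s => Or.inr (h S hP hR hQ s)

/-- Heredity at level `k` implies no premature breakdown at level `k` (the extension lives to `τ (k+1)`). [folklore] -/
theorem HeredityAtGAt.noPrematureBreakdown {k : ℕ} (h : HeredityAtGAt R k) : NoPrematureBreakdownGAt R k := by
  rintro S hP hR hQ ⟨s⟩
  obtain ⟨s', -⟩ := h S hP hR hQ s
  exact s'.livesTo

/-- Heredity from `k₀` implies heredity-or-breakdown from `k₀`. [folklore] -/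
theorem HeredityFromGAt.orBreakdown {k₀ : ℕ} (h : HeredityFromGAt R k₀) : HeredityOrBreakdownFromGAt R k₀ :=
  fun _ hk => (h.heredityAt hk).orBreakdown

/-- **`HeredityAtGAt R k ↔ HeredityOrBreakdownGAt R k ∧ NoPrematureBreakdownGAt R k`** — the register's heredity is
EXACTLY the weak form plus the clause «no registered design dies before `τ (k+1)`». [folklore] -/
theorem heredityAtGAt_iff_orBreakdown_and_noPrematureBreakdown (k : ℕ) :
    HeredityAtGAt R k ↔ HeredityOrBreakdownGAt R k ∧ NoPrematureBreakdownGAt R k := by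
  refine ⟨fun h => ⟨h.orBreakdown, h.noPrematureBreakdown⟩, fun ⟨hO, hN⟩ S hP hR hQ s => ?_⟩
  rcases hO S hP hR hQ s with hdead | hext
  · exact absurd (hN S hP hR hQ ⟨s⟩) hdead
  · exact hext

/-- `HeredityFromGAt R k₀ ↔ HeredityOrBreakdownFromGAt R k₀ ∧ ∀ k ≥ k₀, NoPrematureBreakdownGAt R k`. [folklore] -/
theorem heredityFromGAt_iff_orBreakdown_and_noPrematureBreakdown (k₀ : ℕ) :
    HeredityFromGAt R k₀ ↔ HeredityOrBreakdownFromGAt R k₀ ∧ ∀ k, k₀ ≤ k → NoPrematureBreakdownGAt R k := by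
  refine ⟨fun h => ⟨h.orBreakdown, fun k hk => (h.heredityAt hk).noPrematureBreakdown⟩,
    fun ⟨hO, hN⟩ S hP hR hQ k hk s => ?_⟩
  exact (heredityAtGAt_iff_orBreakdown_and_noPrematureBreakdown k).2 ⟨hO k hk, hN k hk⟩ S hP hR hQ s

/-- **A premature breakdown at ANY rates IS Fefferman's (C)**: if some pinned rigid quiet design on `R` with a
registered stage at level `k` has a flow that does not live to `τ (k+1)`, then `NavierStokesBreakdownR3`.
[cite: FeffermanClay2006, (C)] -/
theorem navierStokesBreakdownR3_of_not_noPrematureBreakdownGAt {k : ℕ} (h : ¬ NoPrematureBreakdownGAt R k) :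
    Summit.NavierStokesRegularity.NavierStokesRegularity.NavierStokesBreakdownR3 := by
  simp only [NoPrematureBreakdownGAt, not_forall] at h
  obtain ⟨S, _, _, _, ⟨s⟩, hdead⟩ := h
  exact s.navierStokesBreakdownR3_of_not_livesTo one_pos (S.τ_pos (k + 1)) hdead

/-- **The weak form recovers the register's heredity OR proves (C) outright.** [folklore] -/
theorem HeredityOrBreakdownGAt.heredityAt_or_breakdownR3 {k : ℕ} (h : HeredityOrBreakdownGAt R k) :
    HeredityAtGAt R k ∨ Summit.NavierStokesRegularity.NavierStokesRegularity.NavierStokesBreakdownR3 := by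
  by_cases hN : NoPrematureBreakdownGAt R k
  · exact Or.inl ((heredityAtGAt_iff_orBreakdown_and_noPrematureBreakdown k).2 ⟨h, hN⟩)
  · exact Or.inr (navierStokesBreakdownR3_of_not_noPrematureBreakdownGAt hN)

/-- Without breakdown the two forms coincide. [folklore] -/
theorem heredityAtGAt_iff_orBreakdown_of_not_breakdownR3 {k : ℕ}
    (hC : ¬ Summit.NavierStokesRegularity.NavierStokesRegularity.NavierStokesBreakdownR3) :
    HeredityAtGAt R k ↔ HeredityOrBreakdownGAt R k :=
  ⟨HeredityAtGAt.orBreakdown, fun h => h.heredityAt_or_breakdownR3.resolve_right hC⟩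

/-- The weak heredity at level `k` yields the window ceiling at level `k` (the survivor's flow IS the extension's
velocity, `Stage.velocity_eq_of_classical`). [cite: Sohr2001, Ch. V Thm. 1.5.1] -/
theorem HeredityOrBreakdownGAt.windowCeiling {k : ℕ} (h : HeredityOrBreakdownGAt R k) : WindowCeilingGAt R k := by
  intro S hP hR hQ s v q hcl hv0 hE t ht x
  rcases h S hP hR hQ s with hdead | ⟨s', -⟩
  · exact absurd ⟨v, q, hcl, hv0, hE⟩ hdead
  · have ht' : t ∈ Icc 0 (S.τ (k + 1)) := ⟨(S.τ_pos k).le.trans ht.1, ht.2⟩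
    rw [s'.velocity_eq_of_classical one_pos le_rfl hcl hv0 hE t ht']
    exact s'.ceiling (k + 1) le_rfl t ht' x

namespace ReadoutGAt

variable {k : ℕ} {P Q : Schedule R → (EuclideanSpace ℝ (Fin 3) → EuclideanSpace ℝ (Fin 3)) → Prop}

/-- The schema is monotone in the predicate. [folklore] -/
theorem mono (hPQ : ∀ S v, P S v → Q S v) (h : ReadoutGAt R k P) : ReadoutGAt R k Q :=
  fun S hP hR hQ s u p hcl hagree hE hceil => hPQ S _ (h S hP hR hQ s u p hcl hagree hE hceil)

/-- The schema commutes with conjunction. [folklore] -/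
theorem and_iff : ReadoutGAt R k (fun S v => P S v ∧ Q S v) ↔ ReadoutGAt R k P ∧ ReadoutGAt R k Q :=
  ⟨fun h => ⟨h.mono fun _ _ h' => h'.1, h.mono fun _ _ h' => h'.2⟩,
    fun h S hP hR hQ s u p hcl hagree hE hceil =>
      ⟨h.1 S hP hR hQ s u p hcl hagree hE hceil, h.2 S hP hR hQ s u p hcl hagree hE hceil⟩⟩

end ReadoutGAt

/-- **The lower half at `(R, k)` splits losslessly into its three floors.** [folklore] -/
theorem readoutFloorsGAt_iff_floors {k : ℕ} :
    ReadoutFloorsGAt R k ↔ SpeedFloorGAt R k ∧ StrainFloorGAt R k ∧ CoreFloorGAt R k := by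
  rw [ReadoutFloorsGAt, SpeedFloorGAt, StrainFloorGAt, CoreFloorGAt, ← ReadoutGAt.and_iff, ← ReadoutGAt.and_iff]

/-- The lower half from its three floors. [folklore] -/
theorem readoutFloorsGAt_of_floors {k : ℕ} (h₁ : SpeedFloorGAt R k) (h₂ : StrainFloorGAt R k)
    (h₃ : CoreFloorGAt R k) : ReadoutFloorsGAt R k :=
  readoutFloorsGAt_iff_floors.2 ⟨h₁, h₂, h₃⟩

end Summit.NavierStokesRegularity.FluidComputer.PalasekTowerClayBridge

end
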